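import Mathlib
import Literature.Analysis.FluidPDE.PlanarCircleWirtinger
import Summits.NavierStokesRegularity.NavierStokesRegularity.Theorems.EulerZoomLiouvillePowerGaugeEulerLiouvilleCondenserLogMeanSquare

/-!
# H-MODES (1/2): FIRST-MODE PROJECTION ON THE CIRCLE, WIRTINGER WITH CONSTANT 4, AND THE CIRCLE INEQUALITY of the hoop lever
(K-HOOP split (b), LEAD 19832 ns-typeII-p2 g14 key 01:25:31Z; HOOP-NOTE dc156936fff7 §4, modal proof)

Width piece for crux `EulerZoomLiouville.PowerGaugeEulerLiouville` (stmt-NavierStokesRegularity-19832); seat ns-ezl-w2 g5,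
`--supports stmt-NavierStokesRegularity-19832 --as helper`.  Class-free 1-D analysis on `[0, 2π]` (real `C¹` functions with
`f (2π) = f 0`; every function arising from a circle `θ ↦ F(axisPt σ t θ)` is of this kind).  The first-mode projection is written
out (no definitions): `P₁f θ = π⁻¹(∫₀^{2π} f cos)·cos θ + π⁻¹(∫₀^{2π} f sin)·sin θ`.

* §1 trigonometric integrals on `[0,2π]`; §2 first-mode functions `A cos + B sin`: `∫(A cos + B sin)·g = A∫g cos + B∫g sin`,
  `∫(A cos + B sin)(A′cos + B′sin) = π(AA′ + BB′)`; orthogonality `∫(A cos + B sin)·(g − P₁g) = 0`; for periodic `C¹` `g`: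
  `∫g′cos = ∫g sin`, `∫g′ sin = −∫g cos` (so `P₁(g′) = (P₁g)′`).
* §3 **`wirtinger_four`** (W4): `∫f cos = ∫f sin = 0 ⇒ 4∫₀^{2π}(f − mean)² ≤ ∫₀^{2π} f′²` (Parseval on `[0,2π]`, Mathlib
  `hasSum_sq_fourierCoeffOn` + `fourierCoeffOn_of_hasDerivAt`: `c_n(f′) = i n c_n(f)`, `c₀ = c_{±1} = 0`).
* §4 **`sharp_modes_nonneg`**: for periodic `C¹` `p, q` with `∫p cos = ∫p sin = 0`: `0 ≤ ∫p′² + ∫q′² + 2∫q² + 4∫p q′`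
  (W4 + Cauchy–Schwarz for the mean) — the modes `m ≠ ±1` of HOOP-NOTE §4.
The circle inequality itself (`hoop_circle_le`, modes `±1` by first-mode algebra) is in the sibling file `…HoopCircleInequality`.

HONEST FRAMING: 1-D lemmas; proves nothing about the crux E (19832 OPEN), the hoop inequality as a whole, or Navier–Stokes
regularity. [folklore (Wirtinger/Parseval); HOOP-NOTE §4]
-/

noncomputable section

open Set Filter Topology Metric Function MeasureTheory Real
open scoped Interval

set_option linter.dupNamespace false

namespace Summit.NavierStokesRegularity.NavierStokesRegularity.Theorems.PowerGaugeEulerLiouville.HoopCore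

/-! ## §1 Trigonometric integrals on `[0, 2π]` -/

/-- `∫₀^{2π} cos² = π`. [folklore] -/
theorem integral_cos_sq_two_pi : ∫ x in (0 : ℝ)..2 * π, Real.cos x ^ 2 = π := by
  rw [integral_cos_sq]; simp

/-- `∫₀^{2π} sin² = π`. [folklore] -/
theorem integral_sin_sq_two_pi : ∫ x in (0 : ℝ)..2 * π, Real.sin x ^ 2 = π := by
  rw [integral_sin_sq]; simp

/-- `∫₀^{2π} sin·cos = 0`. [folklore] -/
theorem integral_sin_mul_cos_two_pi : ∫ x in (0 : ℝ)..2 * π, Real.sin x * Real.cos x = 0 := by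
  rw [integral_sin_mul_cos₁]; simp

/-- `∫₀^{2π} cos = 0`. [folklore] -/
theorem integral_cos_two_pi : ∫ x in (0 : ℝ)..2 * π, Real.cos x = 0 := by
  rw [integral_cos]; simp

/-- `∫₀^{2π} sin = 0`. [folklore] -/
theorem integral_sin_two_pi : ∫ x in (0 : ℝ)..2 * π, Real.sin x = 0 := by
  rw [integral_sin]; simp

/-! ## §2 First-mode functions and the first-mode projection -/

/-- `∫₀^{2π} (A cos + B sin)·g = A ∫₀^{2π} g cos + B ∫₀^{2π} g sin` for continuous `g`. [folklore] -/
theorem integral_firstMode_mul {g : ℝ → ℝ} (hg : Continuous g) (A B : ℝ) :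
    ∫ x in (0 : ℝ)..2 * π, (A * Real.cos x + B * Real.sin x) * g x =
      A * (∫ x in (0 : ℝ)..2 * π, g x * Real.cos x) + B * (∫ x in (0 : ℝ)..2 * π, g x * Real.sin x) := by
  have h1 : IntervalIntegrable (fun x => A * (g x * Real.cos x)) volume 0 (2 * π) :=
    ((hg.mul continuous_cos).const_mul A).intervalIntegrable _ _
  have h2 : IntervalIntegrable (fun x => B * (g x * Real.sin x)) volume 0 (2 * π) :=
    ((hg.mul continuous_sin).const_mul B).intervalIntegrable _ _
  rw [show (fun x => (A * Real.cos x + B * Real.sin x) * g x) =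
      fun x => A * (g x * Real.cos x) + B * (g x * Real.sin x) from funext fun x => by ring,
    intervalIntegral.integral_add h1 h2, intervalIntegral.integral_const_mul, intervalIntegral.integral_const_mul]

/-- `∫₀^{2π} (A cos + B sin)(A′ cos + B′ sin) = π(AA′ + BB′)`. [folklore] -/
theorem integral_firstMode_mul_firstMode (A B A' B' : ℝ) :
    ∫ x in (0 : ℝ)..2 * π, (A * Real.cos x + B * Real.sin x) * (A' * Real.cos x + B' * Real.sin x) =
      π * (A * A' + B * B') := by
  rw [integral_firstMode_mul (by fun_prop) A B]
  have hc : ∫ x in (0 : ℝ)..2 * π, (A' * Real.cos x + B' * Real.sin x) * Real.cos x = A' * π := by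
    rw [show (fun x => (A' * Real.cos x + B' * Real.sin x) * Real.cos x) =
        fun x => A' * Real.cos x ^ 2 + B' * (Real.sin x * Real.cos x) from funext fun x => by ring,
      intervalIntegral.integral_add ((by fun_prop : Continuous fun x => A' * Real.cos x ^ 2).intervalIntegrable _ _)
        ((by fun_prop : Continuous fun x => B' * (Real.sin x * Real.cos x)).intervalIntegrable _ _),
      intervalIntegral.integral_const_mul, intervalIntegral.integral_const_mul, integral_cos_sq_two_pi,
      integral_sin_mul_cos_two_pi, mul_zero, add_zero]
  have hs : ∫ x in (0 : ℝ)..2 * π, (A' * Real.cos x + B' * Real.sin x) * Real.sin x = B' * π := by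
    rw [show (fun x => (A' * Real.cos x + B' * Real.sin x) * Real.sin x) =
        fun x => A' * (Real.sin x * Real.cos x) + B' * Real.sin x ^ 2 from funext fun x => by ring,
      intervalIntegral.integral_add ((by fun_prop : Continuous fun x => A' * (Real.sin x * Real.cos x)).intervalIntegrable _ _)
        ((by fun_prop : Continuous fun x => B' * Real.sin x ^ 2).intervalIntegrable _ _),
      intervalIntegral.integral_const_mul, intervalIntegral.integral_const_mul, integral_sin_sq_two_pi,
      integral_sin_mul_cos_two_pi, mul_zero, zero_add]
  rw [hc, hs]; ring

/-- **First-mode energy**: `∫₀^{2π} (A cos + B sin)² = π(A² + B²)`. [folklore] -/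
theorem integral_firstMode_sq (A B : ℝ) :
    ∫ x in (0 : ℝ)..2 * π, (A * Real.cos x + B * Real.sin x) ^ 2 = π * (A ^ 2 + B ^ 2) := by
  have h := integral_firstMode_mul_firstMode A B A B
  simp only [← sq] at h
  rw [show (fun x => (A * Real.cos x + B * Real.sin x) ^ 2) =
    fun x => (A * Real.cos x + B * Real.sin x) * (A * Real.cos x + B * Real.sin x) from funext fun x => by ring]
  rw [integral_firstMode_mul_firstMode]; ring

/-- **Orthogonality of the first-mode projection**: for continuous `g` and any first-mode function `A cos + B sin`,
`∫₀^{2π} (A cos + B sin)·(g − P₁g) = 0`, `P₁g = π⁻¹(∫g cos) cos + π⁻¹(∫g sin) sin`. [folklore] -/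
theorem integral_firstMode_mul_sub_proj {g : ℝ → ℝ} (hg : Continuous g) (A B : ℝ) :
    ∫ x in (0 : ℝ)..2 * π, (A * Real.cos x + B * Real.sin x) *
        (g x - (π⁻¹ * (∫ y in (0 : ℝ)..2 * π, g y * Real.cos y) * Real.cos x +
          π⁻¹ * (∫ y in (0 : ℝ)..2 * π, g y * Real.sin y) * Real.sin x)) = 0 := by
  set Cg := ∫ y in (0 : ℝ)..2 * π, g y * Real.cos y
  set Sg := ∫ y in (0 : ℝ)..2 * π, g y * Real.sin y
  have h1 : IntervalIntegrable (fun x => (A * Real.cos x + B * Real.sin x) * g x) volume 0 (2 * π) :=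
    (by fun_prop : Continuous fun x => (A * Real.cos x + B * Real.sin x) * g x).intervalIntegrable _ _
  have h2 : IntervalIntegrable (fun x => (A * Real.cos x + B * Real.sin x) *
      (π⁻¹ * Cg * Real.cos x + π⁻¹ * Sg * Real.sin x)) volume 0 (2 * π) :=
    (by fun_prop : Continuous fun x => (A * Real.cos x + B * Real.sin x) *
      (π⁻¹ * Cg * Real.cos x + π⁻¹ * Sg * Real.sin x)).intervalIntegrable _ _
  rw [show (fun x => (A * Real.cos x + B * Real.sin x) * (g x - (π⁻¹ * Cg * Real.cos x + π⁻¹ * Sg * Real.sin x))) =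
      fun x => (A * Real.cos x + B * Real.sin x) * g x -
        (A * Real.cos x + B * Real.sin x) * (π⁻¹ * Cg * Real.cos x + π⁻¹ * Sg * Real.sin x) from
      funext fun x => by ring,
    intervalIntegral.integral_sub h1 h2, integral_firstMode_mul hg, integral_firstMode_mul_firstMode]
  have hπ : (π : ℝ) ≠ 0 := Real.pi_ne_zero
  field_simp
  ring

/-- **First-mode coefficients of a derivative** (integration by parts on the period): for `g` differentiable with continuous
derivative `g′` and `g(2π) = g(0)`: `∫₀^{2π} g′ cos = ∫₀^{2π} g sin` and `∫₀^{2π} g′ sin = −∫₀^{2π} g cos`; hence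
`P₁(g′) = (P₁g)′`. [folklore] -/
theorem firstMode_coeffs_deriv {g g' : ℝ → ℝ} (hg : ∀ x, HasDerivAt g (g' x) x) (hg' : Continuous g')
    (hper : g (2 * π) = g 0) :
    (∫ x in (0 : ℝ)..2 * π, g' x * Real.cos x) = ∫ x in (0 : ℝ)..2 * π, g x * Real.sin x ∧
      (∫ x in (0 : ℝ)..2 * π, g' x * Real.sin x) = -∫ x in (0 : ℝ)..2 * π, g x * Real.cos x := by
  have hgc : Continuous g := continuous_iff_continuousAt.2 fun x => (hg x).continuousAt
  constructor
  · have h := intervalIntegral.integral_mul_deriv_eq_deriv_mul (a := 0) (b := 2 * π) (u := Real.cos)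
      (u' := fun x => -Real.sin x) (v := g) (v' := g') (fun x _ => Real.hasDerivAt_cos x) (fun x _ => hg x)
      ((by fun_prop : Continuous fun x => -Real.sin x).intervalIntegrable _ _) (hg'.intervalIntegrable _ _)
    simp only [Real.cos_two_pi, Real.cos_zero, hper] at h
    rw [show (fun x => g' x * Real.cos x) = fun x => Real.cos x * g' x from funext fun x => mul_comm _ _, h]
    rw [show (fun x => -Real.sin x * g x) = fun x => -(g x * Real.sin x) from funext fun x => by ring,
      intervalIntegral.integral_neg]
    ring
  · have h := intervalIntegral.integral_mul_deriv_eq_deriv_mul (a := 0) (b := 2 * π) (u := Real.sin)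
      (u' := Real.cos) (v := g) (v' := g') (fun x _ => Real.hasDerivAt_sin x) (fun x _ => hg x)
      (continuous_cos.intervalIntegrable _ _) (hg'.intervalIntegrable _ _)
    simp only [Real.sin_two_pi, Real.sin_zero, zero_mul, sub_self, zero_sub] at h
    rw [show (fun x => g' x * Real.sin x) = fun x => Real.sin x * g' x from funext fun x => mul_comm _ _, h,
      show (fun x => Real.cos x * g x) = fun x => g x * Real.cos x from funext fun x => mul_comm _ _]


/-! ## §3 Wirtinger's inequality with constant 4 (no modes `0, ±1`) -/

/-- The Fourier characters of period `2π` on `[0, 2π]`: `fourier (−n) x = exp(−n x i)`. [folklore] -/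
theorem fourier_neg_coe_two_pi (n : ℤ) (x : ℝ) :
    (fourier (-n) (x : AddCircle (2 * π - 0)) : ℂ) = Complex.exp (-((n : ℂ) * x) * Complex.I) := by
  rw [fourier_coe_apply]
  congr 1
  have hπ : (π : ℂ) ≠ 0 := by exact_mod_cast Real.pi_ne_zero
  push_cast
  field_simp
  ring

/-- **Wirtinger's inequality with constant `4`.**  For `f : ℝ → ℝ` with continuous derivative `f′`, `f(2π) = f(0)`, and
vanishing first Fourier modes `∫₀^{2π} f cos = ∫₀^{2π} f sin = 0`:
`4 ∫₀^{2π} (f − m)² ≤ ∫₀^{2π} f′²`, `m = (2π)⁻¹∫₀^{2π} f` (Parseval on `[0,2π]`: `c₀(f − m) = c_{±1} = 0`, `|c_n(f′)| = |n||c_n(f)|`).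
[folklore (Hardy–Littlewood–Pólya §7.7)] -/
theorem wirtinger_four {f f' : ℝ → ℝ} (hf : ∀ x, HasDerivAt f (f' x) x) (hf' : Continuous f')
    (hper : f (2 * π) = f 0) (hcos : ∫ x in (0 : ℝ)..2 * π, f x * Real.cos x = 0)
    (hsin : ∫ x in (0 : ℝ)..2 * π, f x * Real.sin x = 0) :
    4 * ∫ x in (0 : ℝ)..2 * π, (f x - (2 * π)⁻¹ * ∫ y in (0 : ℝ)..2 * π, f y) ^ 2 ≤
      ∫ x in (0 : ℝ)..2 * π, f' x ^ 2 := by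
  have hfc : Continuous f := continuous_iff_continuousAt.2 fun x => (hf x).continuousAt
  have hπ : 0 < π := Real.pi_pos
  have h2π : (0 : ℝ) < 2 * π := by positivity
  set m : ℝ := (2 * π)⁻¹ * ∫ y in (0 : ℝ)..2 * π, f y with hm
  set F : ℝ → ℂ := fun x => ((f x - m : ℝ) : ℂ) with hFdef
  set F' : ℝ → ℂ := fun x => ((f' x : ℝ) : ℂ) with hF'def
  have hF : ∀ x, HasDerivAt F (F' x) x := fun x => by
    have h := ((hf x).sub_const m).ofReal_comp
    simpa [hFdef, hF'def] using h
  have hFc : Continuous F := by rw [hFdef]; fun_prop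
  have hF'c : Continuous F' := by rw [hF'def]; fun_prop
  have PF := hasSum_sq_fourierCoeffOn h2π (Literature.Analysis.FluidPDE.memLp_two_Ioc_of_continuous' hFc 0 (2 * π))
  have PF' := hasSum_sq_fourierCoeffOn h2π (Literature.Analysis.FluidPDE.memLp_two_Ioc_of_continuous' hF'c 0 (2 * π))
  -- the integrals of `F` against `1`, `cos`, `sin` vanish
  have hint1 : ∫ x in (0 : ℝ)..2 * π, (f x - m) = 0 := by
    rw [intervalIntegral.integral_sub (hfc.intervalIntegrable _ _) intervalIntegrable_const,
      intervalIntegral.integral_const, smul_eq_mul, hm]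
    field_simp
    ring
  have hintc : ∫ x in (0 : ℝ)..2 * π, (f x - m) * Real.cos x = 0 := by
    have i1 : IntervalIntegrable (fun x => f x * Real.cos x) volume 0 (2 * π) :=
      (hfc.mul continuous_cos).intervalIntegrable _ _
    have i2 : IntervalIntegrable (fun x => m * Real.cos x) volume 0 (2 * π) :=
      (continuous_const.mul continuous_cos).intervalIntegrable _ _
    rw [show (fun x => (f x - m) * Real.cos x) = fun x => f x * Real.cos x - m * Real.cos x from
        funext fun x => by ring, intervalIntegral.integral_sub i1 i2,
      intervalIntegral.integral_const_mul, integral_cos_two_pi, hcos]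
    ring
  have hints : ∫ x in (0 : ℝ)..2 * π, (f x - m) * Real.sin x = 0 := by
    have i1 : IntervalIntegrable (fun x => f x * Real.sin x) volume 0 (2 * π) :=
      (hfc.mul continuous_sin).intervalIntegrable _ _
    have i2 : IntervalIntegrable (fun x => m * Real.sin x) volume 0 (2 * π) :=
      (continuous_const.mul continuous_sin).intervalIntegrable _ _
    rw [show (fun x => (f x - m) * Real.sin x) = fun x => f x * Real.sin x - m * Real.sin x from
        funext fun x => by ring, intervalIntegral.integral_sub i1 i2,
      intervalIntegral.integral_const_mul, integral_sin_two_pi, hsin]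
    ring
  -- the coefficients `c_0, c_{±1}` of `F` vanish
  have hcoef : ∀ n : ℤ, n = 0 ∨ n = 1 ∨ n = -1 → fourierCoeffOn h2π F n = 0 := by
    intro n hn
    rw [fourierCoeffOn_eq_integral]
    have hI : ∫ x in (0 : ℝ)..2 * π, (fourier (-n) (x : AddCircle (2 * π - 0)) : ℂ) • F x = 0 := by
      simp_rw [fourier_neg_coe_two_pi, smul_eq_mul]
      have key : ∀ x : ℝ, Complex.exp (-((n : ℂ) * x) * Complex.I) * F x =
          (((f x - m) * Real.cos (n * x) : ℝ) : ℂ) - Complex.I * (((f x - m) * Real.sin (n * x) : ℝ) : ℂ) := by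
        intro x
        rw [Complex.exp_mul_I, hFdef]
        push_cast
        rw [Complex.cos_neg, Complex.sin_neg]
        ring
      simp_rw [key]
      rw [intervalIntegral.integral_sub, intervalIntegral.integral_const_mul, intervalIntegral.integral_ofReal,
        intervalIntegral.integral_ofReal]
      · rcases hn with h | h | h <;> subst h <;> simp [hint1, hintc, hints]
      · exact (Complex.continuous_ofReal.comp (by fun_prop)).intervalIntegrable _ _
      · exact ((Complex.continuous_ofReal.comp (by fun_prop)).const_mul _).intervalIntegrable _ _
    rw [hI, smul_zero]
  -- the coefficients of the derivative: `c_n(F′) = i n c_n(F)`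
  have hderiv : ∀ n : ℤ, n ≠ 0 → fourierCoeffOn h2π F' n = (Complex.I * n) * fourierCoeffOn h2π F n := by
    intro n hn
    have h := fourierCoeffOn_of_hasDerivAt h2π hn (fun x _ => hF x) (hF'c.intervalIntegrable _ _)
    have hbd : F (2 * π) - F 0 = 0 := by simp [hFdef, hper]
    rw [hbd, mul_zero, zero_sub] at h
    rw [h]
    have hI : Complex.I ≠ 0 := Complex.I_ne_zero
    have hπ' : (π : ℂ) ≠ 0 := by exact_mod_cast Real.pi_ne_zero
    have hn' : (n : ℂ) ≠ 0 := by exact_mod_cast hn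
    push_cast
    field_simp
    ring_nf
  -- termwise comparison
  have hterm : ∀ n : ℤ, 4 * ‖fourierCoeffOn h2π F n‖ ^ 2 ≤ ‖fourierCoeffOn h2π F' n‖ ^ 2 := by
    intro n
    by_cases h0 : n = 0 ∨ n = 1 ∨ n = -1
    · rw [hcoef n h0, norm_zero]; simp
    · push Not at h0
      obtain ⟨hn0, hn1, hn2⟩ := h0
      rw [hderiv n hn0, norm_mul, norm_mul, Complex.norm_I, one_mul, Complex.norm_intCast, mul_pow]
      have h2 : (2 : ℝ) ≤ |(n : ℝ)| := by
        rw [← Int.cast_abs]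
        have : (2 : ℤ) ≤ |n| := by
          rcases lt_trichotomy n 0 with h | h | h
          · rw [abs_of_neg h]; omega
          · exact absurd h hn0
          · rw [abs_of_pos h]; omega
        exact_mod_cast this
      have h4 : (4 : ℝ) ≤ |(n : ℝ)| ^ 2 := by nlinarith
      have h0' : 0 ≤ ‖fourierCoeffOn h2π F n‖ ^ 2 := sq_nonneg _
      nlinarith
  have hle := hasSum_le hterm (PF.mul_left 4) PF'
  -- translate the two Parseval sums
  have hFsq : ∫ x in (0 : ℝ)..2 * π, ‖F x‖ ^ 2 = ∫ x in (0 : ℝ)..2 * π, (f x - m) ^ 2 :=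
    intervalIntegral.integral_congr fun x _ => by simp only [hFdef, Complex.norm_real, Real.norm_eq_abs, sq_abs]
  have hF'sq : ∫ x in (0 : ℝ)..2 * π, ‖F' x‖ ^ 2 = ∫ x in (0 : ℝ)..2 * π, f' x ^ 2 :=
    intervalIntegral.integral_congr fun x _ => by simp only [hF'def, Complex.norm_real, Real.norm_eq_abs, sq_abs]
  simp only [sub_zero, smul_eq_mul, hFsq, hF'sq] at hle
  have hinv : 0 < (2 * π)⁻¹ := inv_pos.2 h2π
  have h0 : 0 ≤ ∫ x in (0 : ℝ)..2 * π, (f x - m) ^ 2 := intervalIntegral.integral_nonneg h2π.le fun x _ => sq_nonneg _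
  nlinarith [hle, mul_le_mul_of_nonneg_left hle (le_of_lt h2π)]

/-! ## §4 The modes `m ≠ ±1` of the hoop lever -/

/-- **THE `m ≠ ±1` MODES**: for `p, q : ℝ → ℝ` with continuous derivatives, `2π`-periodic values (`p(2π) = p 0`, `q(2π) = q 0`),
and `p` orthogonal to the first modes (`∫₀^{2π} p cos = ∫₀^{2π} p sin = 0`):
`0 ≤ ∫₀^{2π} p′² + ∫₀^{2π} q′² + 2∫₀^{2π} q² + 4∫₀^{2π} p q′`.
Proof: `∫(q′ + 2p)² ≥ (∫(q′+2p))²/(2π) = (2∫p)²/(2π)` (Cauchy–Schwarz; `∫q′ = 0`) and (W4) `∫p′² ≥ 4∫p² − (2∫p)²/(2π)`; the sum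
is `≥ 2∫q² ≥ 0`.  This is `|a|² − |b|² ≤ |ima − b|² + |imb + a|²` for all `|m| ≠ 1` at once (HOOP-NOTE §4). [folklore] -/
theorem sharp_modes_nonneg {p p' q q' : ℝ → ℝ} (hp : ∀ x, HasDerivAt p (p' x) x) (hp' : Continuous p')
    (hpper : p (2 * π) = p 0) (hq : ∀ x, HasDerivAt q (q' x) x) (hq' : Continuous q') (hqper : q (2 * π) = q 0)
    (hcos : ∫ x in (0 : ℝ)..2 * π, p x * Real.cos x = 0) (hsin : ∫ x in (0 : ℝ)..2 * π, p x * Real.sin x = 0) :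
    0 ≤ (∫ x in (0 : ℝ)..2 * π, p' x ^ 2) + (∫ x in (0 : ℝ)..2 * π, q' x ^ 2) +
      2 * (∫ x in (0 : ℝ)..2 * π, q x ^ 2) + 4 * ∫ x in (0 : ℝ)..2 * π, p x * q' x := by
  have hpc : Continuous p := continuous_iff_continuousAt.2 fun x => (hp x).continuousAt
  have hqc : Continuous q := continuous_iff_continuousAt.2 fun x => (hq x).continuousAt
  have h2π : (0 : ℝ) ≤ 2 * π := by positivity
  set P : ℝ := ∫ x in (0 : ℝ)..2 * π, p x with hP
  -- (W4) in expanded form: `4∫p² − (2/π)… ≤ ∫p′²`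
  have hW := wirtinger_four hp hp' hpper hcos hsin
  have hexp : ∫ x in (0 : ℝ)..2 * π, (p x - (2 * π)⁻¹ * ∫ y in (0 : ℝ)..2 * π, p y) ^ 2 =
      (∫ x in (0 : ℝ)..2 * π, p x ^ 2) - P ^ 2 / (2 * π) := by
    rw [← hP]
    have e : (fun x => (p x - (2 * π)⁻¹ * P) ^ 2) =
        fun x => p x ^ 2 - (2 * (2 * π)⁻¹ * P) * p x + ((2 * π)⁻¹ * P) ^ 2 := funext fun x => by ring
    have i1 : IntervalIntegrable (fun x => p x ^ 2) volume 0 (2 * π) := (hpc.pow 2).intervalIntegrable _ _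
    have i2 : IntervalIntegrable (fun x => (2 * (2 * π)⁻¹ * P) * p x) volume 0 (2 * π) :=
      (hpc.const_mul _).intervalIntegrable _ _
    have i3 : IntervalIntegrable (fun _ => ((2 * π)⁻¹ * P) ^ 2) volume 0 (2 * π) := intervalIntegrable_const
    rw [e, intervalIntegral.integral_add (i1.sub i2) i3, intervalIntegral.integral_sub i1 i2,
      intervalIntegral.integral_const_mul, intervalIntegral.integral_const, smul_eq_mul, ← hP]
    field_simp
    ring
  rw [hexp] at hW
  -- Cauchy–Schwarz for `q′ + 2p` against `1`
  have hi1 : IntervalIntegrable (fun x => (q' x + 2 * p x) ^ 2) volume 0 (2 * π) :=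
    ((hq'.add (hpc.const_mul 2)).pow 2).intervalIntegrable _ _
  have hi2 : IntervalIntegrable (fun x => (q' x + 2 * p x) * 1) volume 0 (2 * π) :=
    ((hq'.add (hpc.const_mul 2)).mul continuous_const).intervalIntegrable _ _
  have hCS := Condenser.sq_integral_mul_le_of_intervalIntegrable (f := fun x => q' x + 2 * p x)
    (g := fun _ => (1 : ℝ)) h2π hi1 intervalIntegrable_const hi2
  have hmean : ∫ x in (0 : ℝ)..2 * π, (q' x + 2 * p x) * 1 = 2 * P := by
    simp only [mul_one]
    rw [intervalIntegral.integral_add (hq'.intervalIntegrable _ _) ((hpc.const_mul 2).intervalIntegrable _ _),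
      intervalIntegral.integral_const_mul,
      intervalIntegral.integral_eq_sub_of_hasDerivAt (fun x _ => hq x) (hq'.intervalIntegrable _ _), hqper, sub_self,
      zero_add, hP]
  have hone : ∫ _ in (0 : ℝ)..2 * π, (1 : ℝ) ^ 2 = 2 * π := by simp
  rw [hmean, hone] at hCS
  -- expand `∫(q′ + 2p)²`
  have hsq : ∫ x in (0 : ℝ)..2 * π, (q' x + 2 * p x) ^ 2 =
      (∫ x in (0 : ℝ)..2 * π, q' x ^ 2) + 4 * (∫ x in (0 : ℝ)..2 * π, p x * q' x) +
        4 * ∫ x in (0 : ℝ)..2 * π, p x ^ 2 := by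
    have e : (fun x => (q' x + 2 * p x) ^ 2) = fun x => q' x ^ 2 + 4 * (p x * q' x) + 4 * p x ^ 2 :=
      funext fun x => by ring
    have i1 : IntervalIntegrable (fun x => q' x ^ 2) volume 0 (2 * π) := (hq'.pow 2).intervalIntegrable _ _
    have i2 : IntervalIntegrable (fun x => 4 * (p x * q' x)) volume 0 (2 * π) :=
      ((hpc.mul hq').const_mul 4).intervalIntegrable _ _
    have i3 : IntervalIntegrable (fun x => 4 * p x ^ 2) volume 0 (2 * π) :=
      ((hpc.pow 2).const_mul 4).intervalIntegrable _ _
    rw [e, intervalIntegral.integral_add (i1.add i2) i3, intervalIntegral.integral_add i1 i2,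
      intervalIntegral.integral_const_mul, intervalIntegral.integral_const_mul]
  rw [hsq] at hCS
  have hq2 : 0 ≤ ∫ x in (0 : ℝ)..2 * π, q x ^ 2 := intervalIntegral.integral_nonneg h2π fun x _ => sq_nonneg _
  have hπ : 0 < π := Real.pi_pos
  -- combine: ∫(q′+2p)² ≥ (2P)²/(2π) and ∫p′² ≥ 4∫p² − P²/(2π)·4
  have hCS' : (2 * P) ^ 2 / (2 * π) ≤ (∫ x in (0 : ℝ)..2 * π, q' x ^ 2) +
      4 * (∫ x in (0 : ℝ)..2 * π, p x * q' x) + 4 * ∫ x in (0 : ℝ)..2 * π, p x ^ 2 := by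
    rw [div_le_iff₀ (by positivity)]; linarith [hCS]
  have e1 : (2 * P) ^ 2 / (2 * π) = 4 * (P ^ 2 / (2 * π)) := by ring
  rw [e1] at hCS'
  linarith [hW, hCS', hq2]

end Summit.NavierStokesRegularity.NavierStokesRegularity.Theorems.PowerGaugeEulerLiouville.HoopCore

end
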